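import Literature.AlgebraicGeometry.Resolution.StrictTransformTorsion
import Literature.AlgebraicGeometry.Resolution.AdmissibleBlowups
import Literature.AlgebraicGeometry.Resolution.BlowupsLocal
import Literature.AlgebraicGeometry.Limits.IdealSheafComap
import HarnessLib

/-!
# The strict transform is the blowing up in the pulled-back centre (Stacks 080E)

Topic: `Literature/AlgebraicGeometry/Resolution`. The Stacks Project, Tag 080E (Divisors,
Lemma 31.33.2): "In the situation of Definition 31.33.1 [a blowing up `b : S' → S` in `𝓘`, a
morphism `f : X → S`, the strict transform `X' ⊆ X ×_S S'` of `X`]. (1) The strict transform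
`X'` of `X` is the blowup of `X` in the closed subscheme corresponding to `f⁻¹𝓘 𝒪_X`. […]"
For the scheme-theoretic strict transform `blowupStrictTransform f b 𝓘` of the named fact
`Stacks081R` (`StrictTransformFlattening.lean`; the closure of `(X ×_S S')|_{S' ∖ E}`) and the
tree's universal-property notion of blowing up `IsBlowup` (`Blowups.lean`), this file PROVES

* `isBlowup_blowupStrictTransform` — **`X' → X ×_S S' → X` is the blowing up of `X` in
  `f⁻¹𝓘 𝒪_X`** (for `b` a blowing up of `S` in `𝓘`),
* `isBlowup_blowupStrictTransform_admissible` — along a `U`-admissible blowing up the strict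
  transform `X' → X` is an `f⁻¹U`-admissible blowing up (Stacks, Tag 080F context / 081R),

identifying the closure-style strict transform with the blow-up-style strict transform
(`IsBlowup.strictTransformHom`, `AlterationsNormalFormStrictTransform.lean`, Görtz–Wedhorn 13.91)
beyond closed immersions. Proof: (i) the exceptional divisor pulls back to an effective
Cartier divisor on `X'` — on a chart `W` of `X ×_S S'` where it is cut out by `t`, the ideal of
`X'` is the `t`-power torsion (`mem_ideal_blowupStrictTransform_iff`,
`StrictTransformTorsion.lean`), so `t` is a nonzerodivisor on `Γ(X' ∩ W) = Γ(W)/(t^∞-torsion)`;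
(ii) universality — a morphism `g : W₀ → X` pulling `f⁻¹𝓘` back to an effective Cartier
divisor gives `h : W₀ → S'` (universality of `b`), and `(g, h) : W₀ → X ×_S S'` kills the
torsion ideal (the image of `t` is a local equation of the divisor, a nonzerodivisor), hence
factors through `X'`; uniqueness from that of `h` and the monomorphism `X' → X ×_S S'`.

Also proved here, of independent use: the affine chart formula for pulled-back ideal sheaves on
small affines (`ideal_comap_eq_map_of_le`), small charts of effective Cartier divisors
(`IsEffectiveCartier.exists_chart_le`), and vanishing of an ideal sheaf from vanishing on an
affine neighbourhood of every point (`eq_bot_of_forall_exists_ideal_eq_bot`).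

## References

* The Stacks Project, Tag 080E (Divisors, Lemma 31.33.2 (1)); Tag 080C; Tag 0806.
  [StacksProject]
* U. Görtz, T. Wedhorn, *Algebraic Geometry I*, 2nd ed. (2020), Prop. 13.91, 13.96;
  Example 4.36. [GortzWedhorn2020]
-/

noncomputable section

open CategoryTheory CategoryTheory.Limits AlgebraicGeometry TopologicalSpace

namespace Literature.AlgebraicGeometry.Resolution

universe u

open Literature.AlgebraicGeometry.Limits

/-! ## Generalities on ideal sheaves -/

section General

/-- Restriction between two presentations of the same open is bijective. [folklore] -/
theorem bijective_presheaf_map_of_eq {X : Scheme.{u}} {U V : X.Opens} (e : U = V) (h : U ≤ V) :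
    Function.Bijective (X.presheaf.map (homOfLE h).op) := by
  subst e
  rw [show (homOfLE h).op = 𝟙 _ from Subsingleton.elim _ _, CategoryTheory.Functor.map_id]
  exact Function.bijective_id

/-- **The affine chart formula for the pull-back ideal sheaf, on a small affine**: for affine
opens `U ⊆ Y` and `W ⊆ π⁻¹U`, `(𝒦.comap π)(W) = 𝒦(U) · Γ(X, W)` (Görtz–Wedhorn I, Example 4.36
for `W → U`; the tree's `ideal_comap_eq_map` is the case `W = π⁻¹U`).
[cite: GortzWedhorn2020, Example 4.36 (p. 139)] -/
theorem ideal_comap_eq_map_of_le {X Y : Scheme.{u}} (π : X ⟶ Y) (𝒦 : Y.IdealSheafData)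
    (U : Y.affineOpens) (W : X.affineOpens) (hW : (W : X.Opens) ≤ π ⁻¹ᵁ (U : Y.Opens)) :
    (𝒦.comap π).ideal W = (𝒦.ideal U).map (π.appLE U W hW).hom := by
  haveI : IsAffine (W : Scheme.{u}) := W.2
  -- the chart formula for `g = (W ↪ X → Y)`, whose preimage of `U` is all of `W`
  have htop : ((W : X.Opens).ι ≫ π) ⁻¹ᵁ (U : Y.Opens) = ⊤ := top_le_iff.mp fun x _ => hW x.2
  have hT : IsAffineOpen (((W : X.Opens).ι ≫ π) ⁻¹ᵁ (U : Y.Opens)) := htop ▸ isAffineOpen_top _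
  let T : (W : Scheme.{u}).affineOpens := ⟨_, hT⟩
  have hTtop : (T : (W : Scheme.{u}).Opens) = ⊤ := htop
  have hTW : (T : (W : Scheme.{u}).Opens) ≤ (W : X.Opens).ι ⁻¹ᵁ (W : X.Opens) :=
    le_top.trans (Scheme.Opens.ι_preimage_self _).ge
  have h1 := ideal_comap_eq_map ((W : X.Opens).ι ≫ π) 𝒦 U T rfl
  have e2 : ((W : X.Opens).ι ≫ π).appLE U T (le_of_eq rfl) =
      π.appLE U W hW ≫ (W : X.Opens).ι.appLE W T hTW := by
    rw [Scheme.Hom.appLE_comp_appLE]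
  rw [Scheme.IdealSheafData.comap_comp, Scheme.IdealSheafData.ideal_comap_of_isOpenImmersion,
    e2, CommRingCat.hom_comp, ← Ideal.map_map] at h1
  -- `h1 : (L.ideal ⟨W.ι '' T, _⟩).comap (W.ι.appIso T).inv = ((𝒦 U).map p).map a`, with
  -- `a = W.ι.appLE W T`, `a ≫ (appIso T).inv = r` the restriction `W.ι '' T ≤ W`, a bijection
  have himg : (W : X.Opens).ι ''ᵁ (T : (W : Scheme.{u}).Opens) = W := by
    rw [hTtop, Scheme.Hom.image_top_eq_opensRange, Scheme.Opens.opensRange_ι]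
  have hle : (W : X.Opens).ι ''ᵁ (T : (W : Scheme.{u}).Opens) ≤ W := himg.le
  have hr : (W : X.Opens).ι.appLE W T hTW ≫ ((W : X.Opens).ι.appIso T).inv =
      X.presheaf.map (homOfLE hle).op := Scheme.Hom.appLE_appIso_inv _ _
  have hrb : Function.Bijective (X.presheaf.map (homOfLE hle).op) :=
    bijective_presheaf_map_of_eq himg hle
  have hab : Function.Bijective ((W : X.Opens).ι.appLE W T hTW).hom := by
    have e : (W : X.Opens).ι.appLE W T hTW =
        X.presheaf.map (homOfLE hle).op ≫ ((W : X.Opens).ι.appIso T).hom := by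
      rw [← hr, Category.assoc, Iso.inv_hom_id, Category.comp_id]
    rw [e, CommRingCat.hom_comp, RingHom.coe_comp]
    exact (ConcreteCategory.bijective_of_isIso _).comp hrb
  have h2 := congrArg (Ideal.comap ((W : X.Opens).ι.appLE W T hTW).hom) h1
  rw [Ideal.comap_comap, ← CommRingCat.hom_comp, hr, Ideal.comap_map_of_bijective _ hab] at h2
  rw [← h2, ← (𝒦.comap π).map_ideal (U := ⟨(W : X.Opens).ι ''ᵁ (T : (W : Scheme.{u}).Opens),
    T.2.image_of_isOpenImmersion _⟩) (V := W) hle]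
  exact (Ideal.comap_map_of_bijective _ hrb).symm

/-- Mutual divisibility with a nonzerodivisor: if `(x) = (y)` and `y` is a nonzerodivisor, so is
`x` (a local copy of `Literature.AlgebraicGeometry.Resolution.mem_nonZeroDivisors_of_span_singleton_eq`
of `HypersurfaceTransform.lean`, whose imports are much heavier than this file's). [folklore] -/
private theorem mem_nonZeroDivisors_of_span_eq_span {A : Type*} [CommRing A] {x y : A}
    (h : Ideal.span {x} = Ideal.span {y}) (hy : y ∈ nonZeroDivisors A) : x ∈ nonZeroDivisors A := by
  obtain ⟨a, rfl⟩ : ∃ a, a * y = x := Ideal.mem_span_singleton'.mp (h ▸ Ideal.mem_span_singleton_self x)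
  obtain ⟨c, hc⟩ : ∃ c, c * (a * y) = y := Ideal.mem_span_singleton'.mp (h.symm ▸ Ideal.mem_span_singleton_self y)
  have hca : c * a = 1 := by
    have h1 : (c * a - 1) * y = 0 := by rw [sub_mul, one_mul, mul_assoc, hc, sub_self]
    exact sub_eq_zero.mp ((mem_nonZeroDivisors_iff_right.mp hy) _ h1)
  exact mul_mem (IsUnit.mem_nonZeroDivisors (isUnit_iff_exists_inv.mpr ⟨c, by rwa [mul_comm] at hca⟩)) hy

/-- **Small charts of an effective Cartier divisor**: around every point, inside any given open
neighbourhood, there is an affine open on which the ideal sheaf is generated by a nonzerodivisor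
(basic opens of a chart: nonzerodivisors stay nonzerodivisors in localisations). [folklore] -/
theorem IsEffectiveCartier.exists_chart_le {X : Scheme.{u}} {K : X.IdealSheafData}
    (hK : IsEffectiveCartier K) (w : X) (N : X.Opens) (hw : w ∈ N) :
    ∃ A : X.affineOpens, w ∈ (A : X.Opens) ∧ (A : X.Opens) ≤ N ∧
      ∃ r ∈ nonZeroDivisors Γ(X, A), K.ideal A = Ideal.span {r} := by
  obtain ⟨U₀, hxU₀, f, hf, hfK⟩ := hK w
  obtain ⟨g, hg_le, hxg⟩ := U₀.2.exists_basicOpen_le (V := N) ⟨w, hw⟩ hxU₀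
  refine ⟨X.affineBasicOpen g, hxg, hg_le, X.presheaf.map (homOfLE (X.basicOpen_le g)).op f,
    ?_, ?_⟩
  · haveI := U₀.2.isLocalization_basicOpen g
    exact IsLocalization.nonZeroDivisors_le_comap (M := .powers g) (S := Γ(X, X.basicOpen g)) hf
  · rw [← K.map_ideal (U := X.affineBasicOpen g) (V := U₀) (X.basicOpen_le g), hfK, Ideal.map_span,
      Set.image_singleton]
    rfl

/-- A morphism kills an ideal sheaf whose pull-back along it vanishes. [folklore] -/
theorem le_ker_of_comap_eq_bot {W₀ Y : Scheme.{u}} {K : Y.IdealSheafData} (G : W₀ ⟶ Y)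
    (h : K.comap G = ⊥) : K ≤ G.ker := by
  rw [← Scheme.IdealSheafData.map_bot, Scheme.IdealSheafData.le_map_iff_comap_le, h]

/-- **An ideal sheaf vanishing on an affine neighbourhood of every point vanishes.** [folklore] -/
theorem eq_bot_of_forall_exists_ideal_eq_bot {X : Scheme.{u}} {L : X.IdealSheafData}
    (h : ∀ x : X, ∃ A : X.affineOpens, x ∈ (A : X.Opens) ∧ L.ideal A = ⊥) : L = ⊥ := by
  refine Scheme.IdealSheafData.ext (funext fun U => ?_)
  rw [Scheme.IdealSheafData.ideal_bot, Pi.bot_apply, eq_bot_iff]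
  intro x hx
  -- basic opens `D(g_p) ⊆ U ∩ A_p` around the points `p ∈ U`
  have hp : ∀ p : (U : X.Opens), ∃ g : Γ(X, U), (p : X) ∈ X.basicOpen g ∧
      L.ideal (X.affineBasicOpen g) = ⊥ := fun p => by
    obtain ⟨A, hpA, hA⟩ := h p
    obtain ⟨g, hg_le, hpg⟩ := U.2.exists_basicOpen_le (V := (A : X.Opens)) ⟨p, hpA⟩ p.2
    refine ⟨g, hpg, ?_⟩
    rw [← L.map_ideal (U := X.affineBasicOpen g) (V := A) hg_le, hA, Ideal.map_bot]
  choose g hpg hg using hp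
  have hzero : ∀ p : (U : X.Opens), (X.presheaf.map (homOfLE (X.basicOpen_le (g p))).op) x = 0 :=
    fun p => by
    have hbot : (L.ideal U).map (X.presheaf.map (homOfLE (X.basicOpen_le (g p))).op).hom = ⊥ :=
      (L.map_ideal_basicOpen U (g p)).trans (hg p)
    have hmem := Ideal.mem_map_of_mem (X.presheaf.map (homOfLE (X.basicOpen_le (g p))).op).hom hx
    rw [hbot] at hmem
    exact (Submodule.mem_bot _).mp hmem
  refine X.sheaf.eq_of_locally_eq' (fun p : (U : X.Opens) => X.basicOpen (g p)) U
    (fun p => homOfLE (X.basicOpen_le (g p))) (fun p hpU => Opens.mem_iSup.mpr ⟨⟨p, hpU⟩, hpg _⟩)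
    x 0 fun p => ?_
  rw [map_zero]
  exact hzero p

end General

/-! ## Charts of `X ×_S S'` on which the exceptional divisor is principal -/

section Main

variable {X S S' : Scheme.{u}} (f : X ⟶ S) (b : S' ⟶ S) (I : S.IdealSheafData)

/-- **Charts.** If `b⁻¹𝓘 𝒪_{S'}` is an effective Cartier divisor `E`, every point of
`X ×_S S'` has, inside any open neighbourhood, an affine open neighbourhood `W` with a section
`t ∈ Γ(W)` which generates the ideal of the pulled-back divisor on `W` and with `W ∖ E = D(t)`.
[cite: StacksProject, Tag 080C] -/
theorem exists_chart (hE : IsEffectiveCartier (I.comap b)) (p : ↑(pullback f b))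
    (N : (pullback f b).Opens) (hp : p ∈ N) :
    ∃ (W : (pullback f b).affineOpens) (t : Γ(pullback f b, W)), p ∈ (W : (pullback f b).Opens) ∧
      (W : (pullback f b).Opens) ≤ N ∧
      (pullback.snd f b ⁻¹ᵁ (b ⁻¹ᵁ centreCompl I)) ⊓ (W : (pullback f b).Opens) =
        (pullback f b).basicOpen t ∧
      ((I.comap b).comap (pullback.snd f b)).ideal W = Ideal.span {t} := by
  obtain ⟨V, hxV, s, -, hsV⟩ := hE (pullback.snd f b p)
  obtain ⟨W', hW', hxW', hW'V⟩ := exists_isAffineOpen_mem_and_subset (X := pullback f b) (x := p)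
    (U := N ⊓ pullback.snd f b ⁻¹ᵁ (V : S'.Opens)) ⟨hp, hxV⟩
  have hW'N : W' ≤ N := fun y hy => (hW'V hy).1
  have hW'V' : W' ≤ pullback.snd f b ⁻¹ᵁ (V : S'.Opens) := fun y hy => (hW'V hy).2
  refine ⟨⟨W', hW'⟩, (pullback.snd f b).appLE V W' hW'V' s, hxW', hW'N, ?_, ?_⟩
  · have key : ∀ y, y ∈ (W' : Set _) →
        (y ∈ pullback.snd f b ⁻¹ᵁ centreCompl (I.comap b) ↔ pullback.snd f b y ∈ S'.basicOpen s) := by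
      intro y hyW
      have hyV : pullback.snd f b y ∈ ((V : S'.Opens) : Set S') := hW'V' hyW
      have hset := inter_centreCompl_eq_basicOpen V s hsV
      constructor
      · intro hyO
        have hmem : pullback.snd f b y ∈ ((V : S'.Opens) : Set S') ∩ (centreCompl (I.comap b) : Set S') :=
          Set.mem_inter hyV hyO
        rw [hset] at hmem
        exact hmem
      · intro hys
        have hmem : pullback.snd f b y ∈ ((V : S'.Opens) : Set S') ∩ (centreCompl (I.comap b) : Set S') := by
          rw [hset]
          exact hys
        exact hmem.2
    rw [Scheme.Hom.appLE, CommRingCat.comp_apply, Scheme.basicOpen_res, ← Scheme.preimage_basicOpen,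
      preimage_centreCompl]
    apply le_antisymm
    · intro y hy
      have hy' := Opens.mem_inf.mp hy
      exact Opens.mem_inf.mpr ⟨hy'.2, (key y hy'.2).mp hy'.1⟩
    · intro y hy
      have hy' := Opens.mem_inf.mp hy
      exact Opens.mem_inf.mpr ⟨(key y hy'.1).mpr hy'.2, hy'.1⟩
  · rw [ideal_comap_eq_map_of_le (pullback.snd f b) (I.comap b) V ⟨W', hW'⟩ hW'V', hsV,
      Ideal.map_span, Set.image_singleton]

/-! ## (i) The exceptional divisor restricts to an effective Cartier divisor on the strict transform -/

/-- **The pulled-back exceptional divisor is an effective Cartier divisor on the strict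
transform**: on a chart `W` with local equation `t`, the ideal of `X'` is the `t`-power
torsion, so `t` is a nonzerodivisor on `Γ(X' ∩ W) = Γ(W) / (t-power torsion)`.
[cite: StacksProject, Tag 080E (proof)] -/
theorem isEffectiveCartier_comap_blowupStrictTransformι (hE : IsEffectiveCartier (I.comap b)) :
    IsEffectiveCartier
      (((I.comap b).comap (pullback.snd f b)).comap (blowupStrictTransformι f b I)) := by
  intro x'
  obtain ⟨W, t, hxW, -, hW, hJ⟩ := exists_chart f b I hE (blowupStrictTransformι f b I x') ⊤ trivial
  have hWa : IsAffineOpen (blowupStrictTransformι f b I ⁻¹ᵁ (W : (pullback f b).Opens)) :=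
    W.2.preimage _
  refine ⟨⟨_, hWa⟩, hxW, (blowupStrictTransformι f b I).app W t, ?_, ?_⟩
  · -- `t` is a nonzerodivisor modulo the `t`-power torsion
    refine mem_nonZeroDivisors_iff_right.mpr fun y hy => ?_
    obtain ⟨z, rfl⟩ := (blowupStrictTransformι f b I).app_surjective W W.2 y
    rw [← map_mul, ← RingHom.mem_ker] at hy
    have hker : RingHom.ker ((blowupStrictTransformι f b I).app W).hom =
        (blowupStrictTransformι f b I).ker.ideal W := by
      rw [ker_blowupStrictTransformι]
      exact Scheme.IdealSheafData.ker_subschemeι_app _ W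
    rw [hker, mem_ideal_blowupStrictTransform_iff f b I hE W t hW] at hy
    obtain ⟨n, hn⟩ := hy
    have hz : z ∈ (blowupStrictTransformι f b I).ker.ideal W := by
      rw [mem_ideal_blowupStrictTransform_iff f b I hE W t hW]
      exact ⟨n + 1, by rw [pow_succ, mul_assoc, mul_comm t z, hn]⟩
    rw [← hker, RingHom.mem_ker] at hz
    exact hz
  · rw [ideal_comap_preimage (blowupStrictTransformι f b I) _ W hWa, hJ, Ideal.map_span,
      Set.image_singleton]

/-! ## (ii) Universality, and Stacks 080E -/

/-- **Stacks, Tag 080E (1): the strict transform is the blowing up in the pulled-back centre.**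
For a blowing up `b : S' → S` of `S` in `𝓘` and any morphism `f : X → S`, the strict transform
`X' ⊆ X ×_S S'` of `X` (the scheme-theoretic closure of `(X ×_S S')|_{S' ∖ E}`) together with
its projection `X' → X` is a blowing up of `X` in `f⁻¹𝓘 𝒪_X`. [cite: StacksProject, Tag 080E] -/
theorem isBlowup_blowupStrictTransform (hb : IsBlowup b I) :
    IsBlowup (blowupStrictTransformι f b I ≫ pullback.fst f b) (I.comap f) := by
  have hE := hb.isEffectiveCartier
  have hJ : (I.comap f).comap (blowupStrictTransformι f b I ≫ pullback.fst f b) =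
      ((I.comap b).comap (pullback.snd f b)).comap (blowupStrictTransformι f b I) := by
    rw [← Scheme.IdealSheafData.comap_comp, ← Scheme.IdealSheafData.comap_comp,
      ← Scheme.IdealSheafData.comap_comp, Category.assoc, Category.assoc, pullback.condition]
  refine ⟨hJ ▸ isEffectiveCartier_comap_blowupStrictTransformι f b I hE, fun W₀ g hg => ?_⟩
  -- the morphism `h : W₀ → S'` and `G = (g, h) : W₀ → X ×_S S'`
  have hg' : IsEffectiveCartier (I.comap (g ≫ f)) := by
    rwa [Scheme.IdealSheafData.comap_comp]
  obtain ⟨h, hh, huniq⟩ := hb.universal (g ≫ f) hg'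
  let G : W₀ ⟶ pullback f b := pullback.lift g h (by rw [hh])
  have hGfst : G ≫ pullback.fst f b = g := pullback.lift_fst _ _ _
  have hGsnd : G ≫ pullback.snd f b = h := pullback.lift_snd _ _ _
  -- `G` kills the ideal of the strict transform
  have hK : (blowupStrictTransformι f b I).ker.comap G = ⊥ := by
    refine eq_bot_of_forall_exists_ideal_eq_bot fun w => ?_
    obtain ⟨W, t, hwW, -, hW, hJW⟩ := exists_chart f b I hE (G w) ⊤ trivial
    -- the pulled-back divisor `L = G⁻¹(E)` is `g⁻¹ f⁻¹ 𝓘`, effective Cartier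
    have hL : IsEffectiveCartier (((I.comap b).comap (pullback.snd f b)).comap G) := by
      rw [← Scheme.IdealSheafData.comap_comp, hGsnd, ← Scheme.IdealSheafData.comap_comp, hh,
        Scheme.IdealSheafData.comap_comp]
      exact hg
    obtain ⟨A, hwA, hAW, r, hr, hrA⟩ := hL.exists_chart_le w (G ⁻¹ᵁ (W : (pullback f b).Opens)) hwW
    refine ⟨A, hwA, ?_⟩
    -- the image `τ` of `t` generates `L(A) = (r)`, hence is a nonzerodivisor
    have hτ : G.appLE W A hAW t ∈ nonZeroDivisors Γ(W₀, A) := by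
      refine mem_nonZeroDivisors_of_span_eq_span ?_ hr
      rw [← hrA, ideal_comap_eq_map_of_le G _ W A hAW, hJW, Ideal.map_span, Set.image_singleton]
    rw [ideal_comap_eq_map_of_le G _ W A hAW, Ideal.map_eq_bot_iff_le_ker]
    intro x hx
    rw [RingHom.mem_ker]
    obtain ⟨n, hn⟩ := (mem_ideal_blowupStrictTransform_iff f b I hE W t hW x).mp hx
    have h0 : (G.appLE W A hAW) t ^ n * (G.appLE W A hAW) x = 0 := by
      rw [← map_pow, ← map_mul, hn, map_zero]
    exact (mem_nonZeroDivisors_iff_right.mp (pow_mem hτ n)) _ (by rwa [mul_comm] at h0)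
  have hle : (blowupStrictTransformι f b I).ker ≤ G.ker := le_ker_of_comap_eq_bot G hK
  refine ⟨IsClosedImmersion.lift _ G hle, ?_, fun l hl => ?_⟩
  · show IsClosedImmersion.lift _ G hle ≫ blowupStrictTransformι f b I ≫ pullback.fst f b = g
    rw [← Category.assoc, IsClosedImmersion.lift_fac, hGfst]
  · -- uniqueness: `l ≫ ι = G` by the universal property of `b` and of the fibre product
    have hl' : l ≫ blowupStrictTransformι f b I ≫ pullback.fst f b = g := hl
    have e1 : l ≫ blowupStrictTransformι f b I = G := by
      refine pullback.hom_ext ?_ ?_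
      · rw [Category.assoc, hl', hGfst]
      · rw [Category.assoc, hGsnd]
        refine huniq _ ?_
        show (l ≫ blowupStrictTransformι f b I ≫ pullback.snd f b) ≫ b = g ≫ f
        rw [Category.assoc, Category.assoc, ← pullback.condition, ← hl', Category.assoc,
          Category.assoc]
    rw [← cancel_mono (blowupStrictTransformι f b I), e1, IsClosedImmersion.lift_fac]

/-- **The strict transform along a `U`-admissible blowing up is an `f⁻¹U`-admissible blowing
up**: if `b` is the blowing up of `S` in an ideal sheaf `𝓘` of finite type with support
disjoint from `U`, then `X' → X` is the blowing up of `X` in the ideal sheaf `f⁻¹𝓘 𝒪_X`, which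
is of finite type with support disjoint from `f⁻¹U` (Stacks, Tags 080E and 080K).
[cite: StacksProject, Tag 080E] -/
theorem isBlowup_blowupStrictTransform_admissible (hb : IsBlowup b I)
    (hIfg : ∀ W : S.affineOpens, (I.ideal W).FG) (U : S.Opens)
    (hU : Disjoint (U : Set S) (I.support : Set S)) :
    IsBlowup (blowupStrictTransformι f b I ≫ pullback.fst f b) (I.comap f) ∧
      (∀ W : X.affineOpens, ((I.comap f).ideal W).FG) ∧
      Disjoint ((f ⁻¹ᵁ U : X.Opens) : Set X) ((I.comap f).support : Set X) := by
  refine ⟨isBlowup_blowupStrictTransform f b I hb, fg_ideal_comap f hIfg, ?_⟩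
  rw [Scheme.IdealSheafData.support_comap]
  exact Set.disjoint_left.mpr fun x hxU hxI => Set.disjoint_left.mp hU hxU hxI

end Main

end Literature.AlgebraicGeometry.Resolution

end
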